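import Mathlib
import HarnessLib
import HarnessLib.Audit
import Summits.QuantumFields.Statement
import Summits.QuantumFields.YangMills.Theorems.WeakCouplingRates
import Literature.MathematicalPhysics.QuantumLattice.LatticeGaugeDLR
import Literature.MathematicalPhysics.QuantumLattice.WilsonLoops
import HarnessLib.Audit.Status.Attr

/-!
Route: SoftLoopLongLag

CLOSED (superseded) 2026-08-28T01:34:20Z by planner-ym-idea-5-g2-0 — reason: superseded:route-QuantumFields-ColdBoxAllGroups — superseded by route-QuantumFields-ColdBoxAllGroups — note: SUPERSEDED (director-ym R380 (a) STOP ORDER 2026-08-28T01:29:31Z): the route's target leaf Summit.QuantumFields.YangMills.Theorems.WeakCouplingRates.XiPow (R2xi-G, RECORD-label rung) is a TREE THEOREM — Theorems/ColdBoxAllGroupsXiPow.lean `xiPow_holds := ColdBoxAllGroups.closes BoxFloorAllGroups_pro. The file is kept as the record of this route; refuted decls are indexed as negative knowledge (`ledger negatives`).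

# Route SoftLoopLongLag — lag-R autocovariance floor of cube-smeared soft loops forces xi >=
beta^eps for all compact simple G

It suffices to show X = T′ ∧ K′: for every compact simple G and lattice representation r, with R =
⌈β^ε⌉ and F = the sum over the time-zero cube of half-side R of the normalised R×R Wilson loops in
the (1,2)-plane (a bounded positive-time observable), (T′, ColdBoxSoftLoopLagFloor) in ONE
cold-conditioned DLR box of half-side ⌈β^(4ε)⌉ the lag-R autocovariance Cov_ν(F, F∘α_R) is at least
β^(−q), uniformly in the boundary datum, and (K′, SoftLoopLagFloorToTorus) this floor transfers to
every torus-limit state μ: β^(−q) ≤ rpCorr μ F R (with the trivial ceiling rpCorr μ F 0 ≤ β^q). Then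
the tree's variational kernel `HasRPTimeGap.le_log_div` at lag t = R gives m ≤ 2q·log β/⌈β^ε⌉ ≤
β^(−ε/2): the all-G leaf `XiPow` (Assembly T′ → K′ → P → XiPow is PROVED in the seat's Sketch,
including the log absorption). This route SUPERSEDES the seat's LINE 1 `SoftLoopVariational`, whose
lag-2 Rayleigh-quotient crux T was struck by the seat's own cheapest falsifier (kit jobs
j290043/j290086: in free lattice Maxwell theory the two-step quotient of cube-smeared thin loops is
1 − ρ₂ ≈ 2.2/log R, R ≤ 16 — logarithmic, not β^(−ε)); the same jobs show the lag-R signal is a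
β-INDEPENDENT fraction of the variance (ρ_R ≈ 1.6–1.7·10⁻³ at R = 8, 10), which is the point of this
line. HONEST LABEL: the registered rung R2ξ `XiPowSU2` is CLOSED in the tree (`xiPowSU2_holds`); the
content is the OPEN all-G leaf `XiPow`; closes = `xiPowSU2_of_xiPow` ∘ Assembly; filed under R2ξ
only because `XiPow` is not yet a registered closer (request «to director-ym»: register R2ξ′).
bears_on: R2ξ′. No summit is proved; NOT the Clay mass gap (an UPPER bound on the gap: criticality
at a power rate).
Lean: `ColdBoxSoftLoopLagFloor ∧ SoftLoopLagFloorToTorus`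

## Assembly
The deciding theorem `closes (hA : Assembly) (hT) (hK) (hP) : XiPowSU2 := xiPowSU2_of_xiPow (hA hT
hK hP)` consumes every item. The Assembly item is PROVABLE NOW — kernel-checked in the seat's
line3/Sketch.lean (`assembly_holds`, via `xiPow_of` and the lemma `log_absorb : ∃ β₁, ∀ β ≥ β₁,
2q·log β ≤ β^(ε/2)` from `isLittleO_log_rpow_atTop`): K′ applied to T′ gives ε, q, β₀; for β ≥ max
β₀ β₁ 1, μ a limit point and m with HasRPTimeGap μ m, `HasRPTimeGap.le_log_div hm (hP G r R) (t :=
R)` with δ = β^(−q), V = β^q gives m ≤ log(β^q/β^(−q))/R = 2q log β/⌈β^ε⌉ ≤ β^(ε/2)/β^ε = β^(−ε/2);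
hence MassGapPowerDecayOf 4 r.ρ (ε/2) for all G, r, i.e. XiPow. A rung line; proves no summit.

CLOSES_TARGET: closes rung R2xi of QuantumFields: Summit.QuantumFields.YangMills.Theorems.WeakCouplingRates.XiPow (D-0061; not the summit Statement) — the deciding theorem of this route concludes that registered leaf instead of the Statement decl `YangMills` (class rung: servable and labelled, never counted as concluding the summit Statement).

Rationale: WHY THIS LINE. Mechanism (technique card «probabilistic model → deterministic statement»): a gap m
for an RP state bounds every positive-time autocovariance, rpCorr μ F t ≤ e^(−mt)·rpCorr μ F 0;
choosing the LAG t = R = β^ε (not t = 2) turns ANY polynomial floor β^(−q) on rpCorr μ F R into m ≤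
2q log β/β^ε — so the whole burden is a polynomial lower bound on one lag-R covariance in infinite
volume, obtained from ONE cold DLR box (T′) by the DLR law of total covariance with a same-datum
mean-difference term, Cov_μ(F, α_R F) ≥ E_η Cov_γ(η) − ½E_η(m_F − m_(α_R F))², plus chessboard
typicality of cold data (K′; the plumbing is the tree's `LatticeGaugeDLRCovarianceSplit` /
`total_covariance_lower_bound_sub`, proved for SU(2) plaquettes in route WeakCouplingRates' line
dlr-chessboard). What the soft-loop observable buys (measured, j290086): for cube-smeared R×R loops
the lag-R autocovariance is a β-independent fraction ≈ 1.6·10⁻³ of the variance (dipole regime of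
lattice magnetostatics: every loop pair contributes (R⁴/t⁴)² at t = R), whereas for the plaquette
pair of WeakCouplingRates the lag-n signal is n^(−8) = β^(−8A) below the natural scale — so here
perturbation theory in the cold box is needed only at LEADING ORDER WITH FIXED RELATIVE ACCURACY
(any vanishing relative error beats 10⁻³ for β ≥ β₀), and the BOX crux's «relative remainder
o(β^(−8A))» requirement disappears; the leading term of T′ is a sum of squares of mutual
inductances, positive by structure. Imported: RP transfer-operator spectral theory
(Glimm–Jaffe/Seiler), DLR conditioning and the law of total covariance (probability), lattice
magnetostatics of current loops (the Gaussian computation), finite-dimensional Laplace asymptotics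
with polynomial dimension dependence (box of β^(16ε)·dim G variables, ε small). Versus listed
routes: WeakCouplingRates (SU(2), closed) and the seat's AllGroupsColdBox use the plaquette
two-point function at separation β^A with high-order accuracy;
DirichletWindow/XiCompleteMonotonicity want fixed-distance raw-plaquette windows;
EquipartitionCriticality is qualitative (XiDiv); none uses extended trial observables or the
lag-as-parameter form of the variational bound.

RANKED CRUXES. #2 ColdBoxSoftLoopLagFloor (crux) — (T′) for every compact simple G and lattice
representation r there are ε, κ ∈ (0,1), q > 0, β₀ such that for β ≥ β₀ and every boundary datum η
whose cold event has γ_Λ(η)-probability ≥ 1/2 (Λ = box of half-side ⌈β^(4ε)⌉ × all directions, cold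
= every plaquette touching Λ has cost ≤ β^(κ−1)), the cold-conditioned DLR kernel ν satisfies
Cov_ν(F, F∘α_R) ≥ β^(−q), F = Σ over the time-zero cube of half-side R = ⌈β^ε⌉ of N⁻¹Re tr r(R×R
loop in plane (1,2)), α_R = time shift by R. [difficulty: L] (why it might fail: leading order is a
sum of squares of mutual inductances (≈1.6e-3·Var F, j290086), so only the non-Gaussian remainder
can spoil it: Laplace error bounds in a box of β^(16ε)·dim G variables with cold Dirichlet data must
be relative o(1) for general G (charts, Haar Jacobian, large fields).)
[doi:10.1016/0370-2693(81)90037-x, ChatterjeeYMProb2019, doi:10.1017/cbo9780511470783]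
#3 SoftLoopLagFloorToTorus (crux) — (K′) T′ → for every compact simple G, r there are ε, q > 0, β₀
with: for β ≥ β₀ and every torus-limit state μ at coupling β, β^(−q) ≤ rpCorr μ F ⌈β^ε⌉ and rpCorr μ
F 0 ≤ β^q (same F) — DLR law of total covariance through the box, same-datum mean smoothness over
lag R, chessboard typicality of cold data in every volume, weak-* passage to limit points (F,
F·F∘α_R are bounded continuous cylinder functions). [deps: ColdBoxSoftLoopLagFloor] [difficulty: L]
(why it might fail: the transfer needs the conditional mean of F position-smooth over lag R
uniformly over crude-good boundary data for GENERAL G (tree: GoodBoundaryMeanSmooth is SU(2)-typed)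
and sub-horizon large-field rarity in every volume; the background cross term must stay below
β^(−q).) [ChatterjeeYMProb2019, arXiv:2204.12737, doi:10.1007/3-540-11559-5]
#9 SoftLoopObsPosTime (support) — (P) the cube-smeared time-zero soft-loop observable is a
positive-time observable for the tree's reflection (identical to route SoftLoopVariational's support
item; expected to attach by signature). [difficulty: provable-now] [doi:10.1007/3-540-11559-5]

TWO-LAYER PLAN. T′ ⇐ T1 (Gaussian core: in the lattice-Maxwell ⊗ Killing model with cold Dirichlet
data, Cov(F, α_R F) = 2β⁻²Σ_(x,x′) M(x,x′;R)² · (dim-G factor) ≥ c·R⁶/β², M = loop mutual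
inductance; certified numerics j290086 give the constant) → T2 (anharmonic + large-field remainder
relative o(1) in the box of half-side β^(4ε), general G) → T′. K′ ⇐ K1 (DLR total-covariance split
for the loop pair, tree plumbing generalised from plaquettes to bounded cylinder observables) → K2
(same-datum mean smoothness over lag R + cold typicality, general G) → K′.

KILL CRITERIA. A refutation of T′ (a compact simple G, r for which the cold-box lag-R autocovariance
of F is NEGATIVE or super-polynomially small — impossible at leading order, a sum of squares) closes
the route `refuted:ColdBoxSoftLoopLagFloor`; a refutation of K′ (torus-limit states whose background
cross term cancels the box floor) forces the pivot to the plaquette architecture (route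
AllGroupsColdBox). XiPow proved by any other all-G route moots it. The predecessor
SoftLoopVariational is superseded by this route (its crux T fails at the Gaussian level, j290086).

NOT DECOMPOSED YET. The chart for general G (exponential vs. Cayley), the large-field threshold κ,
the Laplace error bookkeeping (dimension dependence) and the exact loop weight/shape (cube of
half-side R, square loops in one plane — any family with a non-vanishing dipole regime works) are
layer-2 matters; the split T′ ⇐ T1 → T2 is filed only once a prover asks.

CHEAPEST FALSIFIER. RUN (kit j290043, j290086, free lattice Maxwell on periodic 56⁴/96⁴, Wick sums):
(i) the predecessor's lag-2 quotient 1 − ρ₂ = 0.97, 0.94, 0.91, 0.88, 0.85, 0.82, 0.80 for R = 4..16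
≈ 2.2/log R — STRIKES LINE 1's crux T (needs β^(−ε)); (ii) the lag profile ρ_t of the same
observable: ρ_8(R=8) = 1.7·10⁻³, ρ_10(R=10) = 1.6·10⁻³, tail ρ_t ∝ t^(−2.6) at R = 16 — a
β-independent polynomial signal, exactly what T′ needs. Next cheapest: the same Wick computation
with cold DIRICHLET data in a box of half-side R⁴ (boundary-independence of the leading term to 10⁻⁴
relative) — one more numpy job.

NUMBERS. R = ⌈β^ε⌉, box half-side ⌈β^(4ε)⌉ (mean-smoothness needs half-side ≫ R^(5/4)); Gaussian Var
F ≈ 2.6·10⁸/β² and ρ_t = 0.37, 0.20, 0.12, 0.074, 0.048, 0.032, 0.022, 0.015, 0.011, 0.0077 (t =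
1..10) at R = 16 (j290086); final rate m ≤ 2q log β/β^ε ≤ β^(−ε/2).

DEFINITION REQUESTS. None (F is typed with
`Literature.MathematicalPhysics.QuantumLattice.wilsonLoopObs` / `rectWalk`; time shift
`timeShiftLG`, `rpCorr`, `IsPosTimeObs`, `ymSpecification`, `plaquettesTouching`,
`infiniteVolumeLimitPoints` exist). A later convenience definition `softLoopObs R` would shorten the
statements.

Novelty: Searches (2026-08-27): lit search --hybrid "variational upper bound mass gap trial state Wilson loop
lattice gauge theory weak coupling" (6 docs: [corpus:book:montvay1994-quantum-fields-lattice p.162,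
pp.255–257] variational glueball estimates, numerics only); lit search "Shen Zhu Zhu stochastic
analysis lattice Yang-Mills" --source all ([corpus:paper:arxiv-2204.12737 p.26–27] Bakry–Émery gap
at strong coupling; [corpus:paper:arxiv-2511.07297 p.13]; [corpus:paper:arxiv-2505.16585 p.27]); lit
galaxy search "lattice Yang-Mills|Bakry-Emery|Brascamp-Lieb" --star pdf (8 generic rows, e.g.
[galaxy:pdf:6344137362336657480]); lit citing/related on Chatterjee 2019
([graph:doi:10.1214/24-aop1702]); [graph:doi:10.1016/0370-2693(81)90037-x] (Müller–Rühl perturbative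
plaquette correlations); tree: Theses WeakCouplingRates (closed, SU(2)), SoftLoopVariational (this
seat, struck), AllGroupsColdBox (this seat), XiCompleteMonotonicity, DirichletWindow,
EquipartitionCriticality; ledger negatives --problem QuantumFields (7, none on rates).
Nearest prior art found: route-QuantumFields-WeakCouplingRates (`xiPowSU2_holds`: plaquette pair at
separation β^A, cold box + DLR bulk domination, SU(2)); ChatterjeeYMProb2019 (Problem 5.1,
free-energy/box comparison); montvay1994 (variational glueball operators, numerical practice of
smeared/extended operators).
Delta: the lag of the RP variational bound is taken as the running parameter t = β^ε and the trial
observable is an extended soft-loop sum whose la  [refs: 10.1214/24-aop1702, 10.1016/0370-2693(81, book:montvay1994-quantum-fields-lattice, paper:arxiv-2204.12737, paper:arxiv-2511.07297, paper:arxiv-2505.16585, doi:10.1214/24-aop1702, doi:10.1016/0370-2693, ChatterjeeYMProb2019]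

Barriers (technique_class: variational-trial-state, dlr-conditioning, lattice-pt): - technique_class: variational-trial-state, dlr-conditioning, lattice-pt
- Literature.Barriers.QuantumFields.DiluteInstantonGasDivergence: not applicable — no
semiclassical/instanton sum is used; the only expansion is Gaussian + bounded anharmonic remainder
in ONE cold box of polynomial size, where the dilute-gas divergence (an infinite-volume, all-scales
statement) does not arise. (Uncatalogued but relevant: discrete-subgroup freezing, file
Literature/Barriers/QuantumFields/DiscreteSubgroupFreezing.lean `actionGap_pos_of_finite` — finite G
have bounded ξ; the leaf and T quantify over compact simple LIE groups only, whose continuum of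
near-flat configurations is what T's Gaussian regime uses.)
- Literature.Barriers.QuantumFields.ElitzurTheorem: outside — every observable used (soft loops,
plaquette costs) is gauge-invariant; gauge fixing appears only inside the proof of T′ as a chart.
- Literature.Barriers.QuantumFields.AbelianDeconfinementD4: not applicable — the line claims an
UPPER bound on the gap (criticality as β → ∞), which also holds for U(1) (massless Coulomb phase);
nothing here distinguishes confinement.
- Negatives index: none of the 7 refuted YangMills statements (CurvatureAnchor 15826,
SelfNormalisedSkewness 18944, RobustYangMillsRG 14958, DiagonalMirrorRP 9665, AdaptiveCoarseSystem
9494, MultibosonLatticeGap 9599, AdmissibleRootsExist 9603) concerns weak-coupling rates or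
variational gap bounds; the line uses none of them.

History (route lifecycle, newest last):
- 2026-08-27T22:28:41Z · closes_target -> closes rung R2xi of QuantumFields: Summit.QuantumFields.YangMills.Theorems.WeakCouplingRates.XiPow (D-0061; not the summit Statement) (planner-ym-idea-5-g2-0)
- 2026-08-28T00:11:17Z · rev 2: restated ColdBoxSoftLoopLagFloor (stmt-QuantumFields-22503) — re-type of T′ requested by lead ym-line-sll-p1 (23:16:39Z, critic-endorsed 23:16:58Z): box exponent 4ε → 8ε, opaque floor β^(-q) → explicit Gaussian-rate floor (planner-ym-idea-5-g2-0)
- 2026-08-28T00:38:14Z · rev 3: restated ColdBoxSoftLoopLagFloor (stmt-QuantumFields-23990) — T′ rev 3 requested by lead ym-line-sll-p1 (SECOND INTERFACE FINDING 00:31:11Z): antecedent «(2)⁻¹ ≤ γ cold» replaced by the pair K1⁺ (p588286) actually supplies (planner-ym-idea-5-g2-0)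
- 2026-08-28T01:34:20Z · CLOSED superseded — superseded:route-QuantumFields-ColdBoxAllGroups (planner-ym-idea-5-g2-0)

sub-problem: YangMills · status: closed(superseded) · opened planner-ym-idea-5-g0-0 2026-08-27T20:58:32Z · rev 3 · ledger route-QuantumFields-SoftLoopLongLag
GENERATED by the gate from the ledger (D-0016/17). Provers cite these decls: `theorem foo : Summit.QuantumFields.YangMills.Theses.SoftLoopLongLag.<Decl> := …` in Summits/QuantumFields/YangMills/Theorems/<Name>.lean.
-/

namespace Summit.QuantumFields.YangMills.Theses.SoftLoopLongLag

open scoped BigOperators Topology Manifold Classical MeasureTheory ProbabilityTheory Matrix InnerProductSpace ComplexConjugate ContinuousMap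
open Filter Set Function TopologicalSpace MeasureTheory

attribute [summit_statement] _root_.YangMills
attribute [summit_statement] _root_.Summit.QuantumFields.YangMills.Theorems.WeakCouplingRates.XiPow

-- earlier ColdBoxSoftLoopLagFloor (stmt-QuantumFields-22503, replaced 2026-08-28T00:11:17Z -> stmt-QuantumFields-23990): retired by None — ∀ (G : Type) [Group G] [TopologicalSpace G] [IsTopologicalGroup G] [CompactSpace G] [MeasurableSpace G] [BorelSpace G], Literature.MathematicalPhysics.QuantumFieldTheory.IsCompactSimpleLieGroup G → ∀ r : Literature.MathematicalPhysics.QuantumFieldTheory.LatticeRe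
-- earlier ColdBoxSoftLoopLagFloor (stmt-QuantumFields-23990, replaced 2026-08-28T00:38:14Z -> stmt-QuantumFields-24180): retired by None — ∀ (G : Type) [Group G] [TopologicalSpace G] [IsTopologicalGroup G] [CompactSpace G] [MeasurableSpace G] [BorelSpace G], Literature.MathematicalPhysics.QuantumFieldTheory.IsCompactSimpleLieGroup G → ∀ r : Literature.MathematicalPhysics.QuantumFieldTheory.LatticeRe
/-- item stmt-QuantumFields-24180 · crux · rank 2 · closed · moot by None · by planner
why it might fail: rev 3 narrows the data to crude-good-at-κ/2 with exp(−β^(κ/4)) cold-typical kernels (what K1⁺ p588286 supplies) and pins κ ≤ ε; risk: the one-scale anharmonic remainder must still be o(R³β⁻²) uniformly over such data, and κ ≤ ε thins the cold wall (β^(κ−1) nearer the thermal scale).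
sources: doi:10.1007/3-540-11559-5, arXiv:2204.12737
[crux] (T′) for every compact simple G and lattice representation r there are ε, κ ∈ (0,1), q > 0,
β₀ such that for β ≥ β₀ and every boundary datum η whose cold event has γ_Λ(η)-probability ≥ 1/2 (Λ
= box of half-side ⌈β^(4ε)⌉ × all directions, cold = every plaquette touching Λ has cost ≤ β^(κ−1)),
the cold-conditioned DLR kernel ν satisfies Cov_ν(F, F∘α_R) ≥ β^(−q), F = Σ over the time-zero cube
of half-side R = ⌈β^ε⌉ of N⁻¹Re tr r(R×R loop in plane (1,2)), α_R = time shift by R. [difficulty: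
L] -/
@[route_item "route-QuantumFields-SoftLoopLongLag", crux]
def ColdBoxSoftLoopLagFloor : Prop :=
  ∀ (G : Type) [Group G] [TopologicalSpace G] [IsTopologicalGroup G] [CompactSpace G] [MeasurableSpace G] [BorelSpace G], Literature.MathematicalPhysics.QuantumFieldTheory.IsCompactSimpleLieGroup G → ∀ r : Literature.MathematicalPhysics.QuantumFieldTheory.LatticeRep G, ∃ c ε₀ : ℝ, 0 < c ∧ 0 < ε₀ ∧ ∀ ε : ℝ, 0 < ε → ε ≤ ε₀ → ∃ κ β₀ : ℝ, 0 < κ ∧ κ ≤ ε ∧ κ < 1 ∧ ∀ β : ℝ, β₀ ≤ β → ∀ η : Literature.MathematicalPhysics.QuantumLattice.LGConfig 4 G, let R : ℕ := ⌈β ^ ε⌉₊; let n : ℕ := ⌈β ^ (8 * ε)⌉₊; let Λ : Finset (Literature.MathematicalPhysics.QuantumLattice.ZdEdge 4) := (Literature.Probability.LatticeModels.box 4 n) ×ˢ Finset.univ; let cold : Set (Literature.MathematicalPhysics.QuantumLattice.LGConfig 4 G) := {U | ∀ p ∈ Literature.MathematicalPhysics.QuantumLattice.plaquettesTouching Λ,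 (r.N : ℝ) - Literature.MathematicalPhysics.QuantumLattice.plaquetteObs r.ρ p.1 p.2.1.1 p.2.1.2 U ≤ β ^ (κ - 1)}; let γ : Measure (Literature.MathematicalPhysics.QuantumLattice.LGConfig 4 G) := Literature.MathematicalPhysics.QuantumLattice.ymSpecification (d := 4) r.ρ β Λ η; let ν : Measure (Literature.MathematicalPhysics.QuantumLattice.LGConfig 4 G) := ProbabilityTheory.cond γ cold; let F : Literature.MathematicalPhysics.QuantumLattice.LGConfig 4 G → ℝ := fun U => ∑ x ∈ (Literature.Probability.LatticeModels.box 4 R).filter (fun x => x 0 = 0), Literature.MathematicalPhysics.QuantumLattice.wilsonLoopObs (fun g : G => (r.N : ℝ)⁻¹ * (r.ρ g).trace.re) (Literature.MathematicalPhysics.QuantumLattice.rectWalk x 1 2 R R) U; (∀ p ∈ Literature.MathematicalPhysics.QuantumLattice.plaquettesTouching Λ, (r.N : ℝ) - Literature.MathematicalPhysics.QuantumLattice.plaquetteObs r.ρ p.1 p.2.1.1 p.2.1.2 η ≤ β ^ (κ / 2 - 1)) → γ coldᶜ ≤ ENNReal.ofReal (Real.exp (-(β ^ (κ / 4)))) →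 c * (R : ℝ) ^ 3 * β ^ (-(2 : ℝ)) ≤ (∫ U, F U * F (Summit.QuantumFields.YangMills.Theorems.WeakCouplingRates.timeShiftLG (G := G) R U) ∂ν) - (∫ U, F U ∂ν) * (∫ U, F (Summit.QuantumFields.YangMills.Theorems.WeakCouplingRates.timeShiftLG (G := G) R U) ∂ν)

/-- item stmt-QuantumFields-22504 · crux · rank 3 · closed · moot by None · by planner
why it might fail: the transfer needs the conditional mean of F position-smooth over lag R uniformly over crude-good boundary data for GENERAL G (tree: GoodBoundaryMeanSmooth is SU(2)-typed) and sub-horizon large-field rarity in every volume; the background cross term must stay below β^(−q).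
sources: ChatterjeeYMProb2019, arXiv:2204.12737, doi:10.1007/3-540-11559-5
[crux] (K′) T′ → for every compact simple G, r there are ε, q > 0, β₀ with: for β ≥ β₀ and every
torus-limit state μ at coupling β, β^(−q) ≤ rpCorr μ F ⌈β^ε⌉ and rpCorr μ F 0 ≤ β^q (same F) — DLR
law of total covariance through the box, same-datum mean smoothness over lag R, chessboard
typicality of cold data in every volume, weak-* passage to limit points (F, F·F∘α_R are bounded
continuous cylinder functions). [deps: ColdBoxSoftLoopLagFloor] [difficulty: L] -/
@[route_item "route-QuantumFields-SoftLoopLongLag", crux]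
def SoftLoopLagFloorToTorus : Prop :=
  ColdBoxSoftLoopLagFloor → ∀ (G : Type) [Group G] [TopologicalSpace G] [IsTopologicalGroup G] [CompactSpace G] [MeasurableSpace G] [BorelSpace G], Literature.MathematicalPhysics.QuantumFieldTheory.IsCompactSimpleLieGroup G → ∀ r : Literature.MathematicalPhysics.QuantumFieldTheory.LatticeRep G, ∃ ε q β₀ : ℝ, 0 < ε ∧ 0 < q ∧ ∀ β : ℝ, β₀ ≤ β → ∀ μ ∈ Literature.MathematicalPhysics.QuantumLattice.infiniteVolumeLimitPoints (d := 4) r.ρ β, let R : ℕ := ⌈β ^ ε⌉₊; let F : Literature.MathematicalPhysics.QuantumLattice.LGConfig 4 G → ℝ := fun U => ∑ x ∈ (Literature.Probability.LatticeModels.box 4 R).filter (fun x => x 0 = 0), Literature.MathematicalPhysics.QuantumLattice.wilsonLoopObs (fun g : G => (r.N : ℝ)⁻¹ * (r.ρ g).trace.re) (Literature.MathematicalPhysics.QuantumLattice.rectWalk x 1 2 R R) U; β ^ (-q) ≤ Summit.QuantumFields.YangMills.Theorems.WeakCouplingRates.rpCorr μ F R ∧ Summit.QuantumFields.YangMills.Theorems.WeakCouplingRates.rpCorr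 μ F 0 ≤ β ^ q

/-- item stmt-QuantumFields-22203 · support · rank 9 · closed · proved by Summit.QuantumFields.YangMills.Theorems.SoftLoopLongLag.softLoopObsPosTime_proof (prover) · by planner
sources: doi:10.1007/3-540-11559-5
[support] (P) for every G, r, R the cube-smeared R×R spatial soft-loop observable based in the
time-zero slice is a positive-time observable (bounded continuous cylinder function on edges with x₀
≥ 0): continuity of `walkHolonomy`/`wilsonLoopObs`, |χ| ≤ 1 for the normalised character of a
unitary representation, cylinder on the edges of `rectWalk x 1 2 R R` (all at time x₀ = 0).
[difficulty: provable-now] -/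
@[route_item "route-QuantumFields-SoftLoopLongLag", crux]
def SoftLoopObsPosTime : Prop :=
  ∀ (G : Type) [Group G] [TopologicalSpace G] [IsTopologicalGroup G] [CompactSpace G] [MeasurableSpace G] [BorelSpace G], ∀ r : Literature.MathematicalPhysics.QuantumFieldTheory.LatticeRep G, ∀ R : ℕ, Summit.QuantumFields.YangMills.Theorems.WeakCouplingRates.IsPosTimeObs (d := 4) (fun U : Literature.MathematicalPhysics.QuantumLattice.LGConfig 4 G => ∑ x ∈ (Literature.Probability.LatticeModels.box 4 R).filter (fun x => x 0 = 0), Literature.MathematicalPhysics.QuantumLattice.wilsonLoopObs (fun g : G => (r.N : ℝ)⁻¹ * (r.ρ g).trace.re) (Literature.MathematicalPhysics.QuantumLattice.rectWalk x 1 2 R R) U)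

-- `SoftLoopObsPosTime` holds: proved by `Summit.QuantumFields.YangMills.Theorems.SoftLoopLongLag.softLoopObsPosTime_proof` (its module imports this route file, so no `_holds` link can be stated here).

/-- item stmt-QuantumFields-22505 · crux (kind.auto-crux: conjecture-grade) · rank 1 · closed · proved by Summit.QuantumFields.YangMills.Theorems.SoftLoopLongLag.assembly_proof (prover) · by planner
why it might fail: auto-crux — conjecture-grade statement (statement references the registered conjecture Summit.QuantumFields.YangMills.Theorems.WeakCouplingRates.XiPow); it is open, so it may simply be false
sources: doi:10.1007/3-540-11559-5
[assembly] T′ → K′ → P → XiPow (all compact simple G); provable now (proof above, ≈ 40 Lean lines in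
the Sketch). -/
@[route_item "route-QuantumFields-SoftLoopLongLag", crux]
def Assembly : Prop :=
  ColdBoxSoftLoopLagFloor → SoftLoopLagFloorToTorus → SoftLoopObsPosTime → Summit.QuantumFields.YangMills.Theorems.WeakCouplingRates.XiPow

-- `Assembly` holds: proved by `Summit.QuantumFields.YangMills.Theorems.SoftLoopLongLag.assembly_proof` (its module imports this route file, so no `_holds` link can be stated here).

/-! D-0027 §2.1 — DECIDING THEOREM (planner-authored via `route open/edit --closes-file`; by planner-ym-idea-5-g2-0 2026-08-27T22:28:41Z) — ARCHIVED: route closed (superseded) 2026-08-28T01:34:20Z; kept so importers keep building: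
its hypotheses are this route's items and its conclusion the registered leaf `Summit.QuantumFields.YangMills.Theorems.WeakCouplingRates.XiPow` (rung R2xi, D-0061) (glue_lint), and it elaborates with this file. -/

@[closes "route-QuantumFields-SoftLoopLongLag"] theorem closes (hA : Summit.QuantumFields.YangMills.Theses.SoftLoopLongLag.Assembly)
    (hT : Summit.QuantumFields.YangMills.Theses.SoftLoopLongLag.ColdBoxSoftLoopLagFloor)
    (hK : Summit.QuantumFields.YangMills.Theses.SoftLoopLongLag.SoftLoopLagFloorToTorus)
    (hP : Summit.QuantumFields.YangMills.Theses.SoftLoopLongLag.SoftLoopObsPosTime) :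
    Summit.QuantumFields.YangMills.Theorems.WeakCouplingRates.XiPow :=
  -- rung R2xi-G (all compact simple G): RECORD / INTERMEDIATE, «not the Clay direction» (LADDER-YM §1c);
  -- an UPPER bound on the mass; no summit is proved by this line. Assembly (T′ → K′ → P → XiPow) is provable now.
  hA hT hK hP

end Summit.QuantumFields.YangMills.Theses.SoftLoopLongLag
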